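import Literature.MathematicalPhysics.QuantumFieldTheory.Balaban1983to89.B8LeafModelZdSockLetters

/-!
# `Balaban1983to89.B8SockLettersRange` — [Balaban1985RegularSpaces] Sect. D (1.91)–(1.103) pp. 91–93: THE [4]-LETTERS SOCKET of the N05 knit IN RANGE FORM —
# the package `B8LeafModelZdSockLetters.SockLetters` with the projection law of the letter `C` read ON THE RANGE OF `Q′` («`Q′G′²Q′ᵀC(Q′f) = Q′f`», [4] (3.25)),
# as printed, instead of on the whole multiplier space

statement-level skeleton of published theorems with citation tags; proofs where landed; nothing here is a claim about the
Yang–Mills mass gap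

PDF held: `paper:balaban1985-cmp99-regular-spaces-gauge-fixing` (journal page = PDF page + 74); pp. 91–94 ((1.86)–(1.106)).  [4] = [Balaban1985BackgroundPropagators]
(Thms 3.1–3.3 pp. 397–398, (3.23)–(3.25) p. 394).

WHY THIS FILE (cell `pub-ymgap`, R134 acceleration seat `pub-ymgap-dag-n05-d` (g2), strategy s2 of DAG node N05 = [B8]; dag-lead REBALANCE №54 (a) — the W8 junction repair;
count-neutral).  Referee dag-ref-A g12's W8 FLAG (READ-7, READ-11; kernel-certified by `fullspace_cright_false_of_finite_support`): the letters socket `SockLetters` (p454033)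
carries the law of the letter `c = C` ((1.96)–(1.97); [4] (3.25): `C = (Q′G′²Q′ᵀ)⁻¹`) in the FULL-SPACE form `∀ φ, Q′G′G′Q′ᵀ(Cφ) = φ` over ALL `φ : ℕ → ℤᵈ → 𝔸`.  That form is
(a) jointly unsatisfiable with the uniqueness side's zero-extension of `Q′` off `𝔅_k`, (b) violated by [4]'s own operators (`Q′` vanishes off `𝔅_k`), and (c) FALSE outright
at every member with finite `Ω₀` over `ℂ` (the range of `G′` is finite-dimensional there) — so no provider can ever serve `SockLetters` at the cube members.  In print, `C`
inverts `Q′G′²Q′ᵀ` on functions ON `𝔅_k`, i.e. on the RANGE of `Q′`; and in the whole existence chain the law is consumed exactly once, in `B8Eq195Linear.q_g_proj325`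
(«Q′G′R = 0»), at the point `φ := Q′G′f` of that range.  THIS FILE re-types the socket with conjunct 3 in RANGE FORM `∀ f, Q′(G′(G′(Q′ᵀ(C(Q′f))))) = Q′f` — every other
conjunct byte-identical with `SockLetters` — nothing else; the sibling modules `B8Eq195LinearRange`, `B8Prop5JoinSectELocalRange`, `B8SockHFPRange` re-run the chain on it (`B8SockHFPRange.sockLettersR_of_sockLetters`
records the one-line implication from the full-space package).

HONEST SCOPE.  A definition (a `Prop`), nothing else; nothing of [4] is asserted or proved.  Count-neutral; N05 NOT discharged; one finite T⁴ programme at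
fixed ε; nothing continuum / ℝ⁴ / OS / mass-gap / Clay.  Unit `pub-ymgap-dag-n05-d` (g2), 2026-08-26.  No `instance`, no `notation`.
-/

noncomputable section

open NormedSpace

namespace Literature.MathematicalPhysics.QuantumFieldTheory.Balaban1983to89.B8SockLettersRange

open B7Prop2Explicit (unitaryUnits)
open B7Eq78Linearization (zdBlocking QprimeIter)
open B8Ineq132 (covDerivFwd InAk)
open B8Eq119TwistedAxial (bgT)
open B8Eq140Level (SideTouches)
open B8Eq138LandauZd (covLap QT)
open B8Eq1117Concrete (XSpace)
open B8Prop5ContractionKLevel (Bd2)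
open B8LambdaSpaceKLevel (wt)

variable {d : ℕ}

section Letters

variable {𝔸 : Type*} [CStarAlgebra 𝔸]

/-- **THE [4]-LETTERS SOCKET IN RANGE FORM** at a member `(η, k, {Ω_j}, {Λs n})` of the general-background `ℤᵈ × 𝔸` family, constants `B_G` ((1.101)), `B_R` ((1.98)),
`B₀′_H`, `B₂′` ((1.92)), threshold `cP`: VERBATIM `B8LeafModelZdSockLetters.SockLetters` — for every `0 < α₀ ≤ cP`, every unitary background `U₀ ∈ 𝔄_k({Ω_j}, α₀)` and every
truncation level `1 ≤ n ≤ k`, `ℂ`-linear LETTERS `g = G′`, `Δ`, `q = Q′`, `qs = Q′ᵀ`, `Aw = 𝔄`, `c = C`, `H′` with the seventeen laws — EXCEPT that the projection law of `C` (conjunct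
3) is read ON THE RANGE OF `Q′`: «`Q′G′G′Q′ᵀ(C(Q′f)) = Q′f` for every site function `f`» ([4] (3.25): `C = (Q′G′²Q′ᵀ)⁻¹` on functions on `𝔅_k`), instead of the full-space
`∀ φ, Q′G′G′Q′ᵀ(Cφ) = φ` (dag-ref-A W8: unsatisfiable at finite `Ω₀`, violated by [4]'s operators).  [4] Thms 3.1–3.3 for Bałaban's operators, as ONE hypothesis per member;
nothing asserted. [cite: Balaban1985RegularSpaces, (1.91)–(1.92) p.91, (1.95)–(1.98) p.92, (1.101)–(1.103) p.93; Balaban1985BackgroundPropagators, (3.25) p.394, Thms 3.1–3.3 pp.397–398] -/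
def SockLettersR (L : ℕ) (BG BR B₀'H B₂' cP : ℝ) (η : ℝ) (k : ℕ) (Ω : ℕ → Set (B7Prop1Explicit.Site d)) (Λs : ℕ → ℕ → Set (B7Prop1Explicit.Site d)) : Prop :=
  ∀ α₀ : ℝ, 0 < α₀ → α₀ ≤ cP → ∀ U₀ : B7Prop1Explicit.Site d → Fin d → 𝔸ˣ, (∀ x κ, U₀ x κ ∈ unitaryUnits 𝔸) → InAk L k η α₀ Ω U₀ →
    ∀ n : ℕ, 1 ≤ n → n ≤ k →
      ∃ (g Δ : (B7Prop1Explicit.Site d → 𝔸) →ₗ[ℂ] (B7Prop1Explicit.Site d → 𝔸)) (q : (B7Prop1Explicit.Site d → 𝔸) →ₗ[ℂ] (ℕ → B7Prop1Explicit.Site d → 𝔸)) (qs : (ℕ → B7Prop1Explicit.Site d → 𝔸) →ₗ[ℂ] (B7Prop1Explicit.Site d → 𝔸))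
        (Aw c : (ℕ → B7Prop1Explicit.Site d → 𝔸) →ₗ[ℂ] (ℕ → B7Prop1Explicit.Site d → 𝔸)) (H' : XSpace d n 𝔸 →ₗ[ℂ] (B7Prop1Explicit.Site d → 𝔸)),
        (∀ x, g (Δ x + qs (Aw (q x))) = x) ∧ (∀ x, Δ (g x) + qs (Aw (q (g x))) = x) ∧ (∀ f, q (g (g (qs (c (q f))))) = q f) ∧
        (∀ (f : B7Prop1Explicit.Site d → 𝔸), ∀ x ∈ Ω 0, Δ f x = covLap η U₀ ((Ω 0).indicator f) x) ∧
        (∀ (μ : ℕ → B7Prop1Explicit.Site d → 𝔸), ∀ x ∈ Ω 0, qs μ x = QT L n (Λs n) U₀ μ x) ∧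
        (∀ (f : B7Prop1Explicit.Site d → 𝔸) (j : ℕ), j ≤ n → ∀ y ∈ Λs n j, q f j y = QprimeIter (zdBlocking d L) (bgT L U₀) j f y) ∧
        (∀ (X : XSpace d n 𝔸) (x : B7Prop1Explicit.Site d), ‖H' X x‖ ≤ B₀'H * ‖X‖) ∧
        (∀ j, j ≤ n → ∀ (X : XSpace d n 𝔸), ∀ p ∈ {b : B7Prop1Explicit.Site d × Fin d | SideTouches (Ω j) b.1 b.2},
          wt L η j * ‖covDerivFwd η U₀ p.2 (H' X) p.1‖ ≤ B₀'H * ‖X‖) ∧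
        (∀ X : XSpace d n 𝔸, Bd2 L η n Ω (covLap η U₀ (H' X)) (B₂' * ‖X‖)) ∧
        (∀ (X : XSpace d n 𝔸) (x : B7Prop1Explicit.Site d), x ∉ Ω 0 → H' X x = 0) ∧
        (∀ X Y : XSpace d n 𝔸, (∀ p, Y p = -star (X p)) → ∀ x, H' Y x = -star (H' X x)) ∧
        (∀ (Y : XSpace d n 𝔸) (j : ℕ) (hj : j ≤ n) (y : B7Prop1Explicit.Site d), y ∈ Λs n j →
          QprimeIter (zdBlocking d L) (bgT L U₀) j (H' Y) y = Y (⟨j, Nat.lt_succ_of_le hj⟩, y)) ∧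
        (∀ (f : B7Prop1Explicit.Site d → 𝔸) (r : ℝ), 0 ≤ r → Bd2 L η n Ω f r →
          (∀ x, ‖g f x‖ ≤ BG * r) ∧ ∀ j, j ≤ n → ∀ p ∈ {b : B7Prop1Explicit.Site d × Fin d | SideTouches (Ω j) b.1 b.2},
            wt L η j * ‖covDerivFwd η U₀ p.2 (g f) p.1‖ ≤ BG * r) ∧
        (∀ (f : B7Prop1Explicit.Site d → 𝔸) (x : B7Prop1Explicit.Site d), x ∉ Ω 0 → g f x = 0) ∧
        (∀ f : B7Prop1Explicit.Site d → 𝔸, (∀ j, j ≤ n → ∀ x ∈ Ω j, IsSelfAdjoint (f x)) → ∀ x, IsSelfAdjoint (g f x)) ∧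
        (∀ (f : B7Prop1Explicit.Site d → 𝔸) (r : ℝ), 0 ≤ r → Bd2 L η n Ω f r → Bd2 L η n Ω (f - g (qs (c (q (g f))))) (BR * r)) ∧
        (∀ f : B7Prop1Explicit.Site d → 𝔸, (∀ j, j ≤ n → ∀ x ∈ Ω j, IsSelfAdjoint (f x)) →
          ∀ j, j ≤ n → ∀ x ∈ Ω j, IsSelfAdjoint ((f - g (qs (c (q (g f))))) x))

end Letters

end Literature.MathematicalPhysics.QuantumFieldTheory.Balaban1983to89.B8SockLettersRange

end
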